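import Summits.AtomisticToContinuum.FouriersLaw.Theorems.BondHeatUncertaintySubdiffusiveBondHeatGibbsPositionEighthMoment
import Summits.AtomisticToContinuum.FouriersLaw.Theorems.BondHeatUncertaintySubdiffusiveBondHeatSiteEnergyCurrentCovariance

/-!
# Extensivity of the current's `L²(Gibbs)` norm, I: coefficient algebra and Gaussian integration by parts

Support file for item `stmt-AtomisticToContinuum-9139` (`OddSectorIrreversibility.OddCorrectorDecay`), negative
side, towards the bath-locality estimate (static input `M_N = ‖J‖²_{L²(μ_T)} ≥ c (N-2) Z_N`).
* `sq_neighbour_dist_le_coeff_sq` — for the pinned chain's coupling `V'(r) = r + βr³`, the momentum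
  coefficient of the total current at an interior site, `c = -(V'(s-a) + V'(b-s))/2`, equals
  `-(b-a)(1 + β((s-a)² - (s-a)(b-s) + (b-s)²))/2`, hence `c² ≥ (b-a)²/4` — the current cannot be small
  unless the next-nearest neighbours coincide.
* `totalCurrent_eq_sum_momentum_mul_coeff` — for an oscillator chain the total current is linear in the
  momenta, `J(q,p) = ∑_m p_m c_m(q)` with `c_m(q) = ∑_j [j=m+1] (-V'(q_j-q_m)/2) + ∑_i [m=i+1] (-V'(q_m-q_i)/2)`.
* `pinnedChain_integral_momentum_coeff_totalCurrent` — for the pinned chain and `T > 0`, Gaussian integration by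
  parts in each momentum (`⟨p_m F⟩_T = T⟨∂_{p_m}F⟩_T` against `e^{-H/T}`, via
  `SubdiffusiveBondHeat.integral_mul_eq_neg_of_hasLineDerivAt_of_integrable`): `∫ p_m c_m J e^{-H/T} =
  T ∫ c_m² e^{-H/T}`; summed over `m` this is `∫ J² e^{-H/T} = T ∫ (∑_m c_m²) e^{-H/T}` (part II).
-/

noncomputable section

open MeasureTheory Set Finset
open scoped ENNReal
open Literature.MathematicalPhysics.KineticTheory.HeatConduction
open Summit.AtomisticToContinuum.FouriersLaw.Theorems.SubdiffusiveBondHeat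

namespace Summit.AtomisticToContinuum.FouriersLaw.Theorems.ChainVariation

/-! ### The interior momentum coefficient of the current -/

/-- Sum of cubes behind the interior coefficient: `-((s-a) + β(s-a)³ + (b-s) + β(b-s)³)/2 =
-(b-a)(1 + β((s-a)² - (s-a)(b-s) + (b-s)²))/2`. [folklore] -/
theorem interiorCoeff_eq (β a b s : ℝ) :
    -((s - a) + β * (s - a) ^ 3 + ((b - s) + β * (b - s) ^ 3)) / 2 =
      -(b - a) * (1 + β * ((s - a) ^ 2 - (s - a) * (b - s) + (b - s) ^ 2)) / 2 := by
  ring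

/-- **The current coefficient dominates the next-nearest-neighbour distance**: for the FPU-`β` coupling
`V'(r) = r + βr³` (`β ≥ 0`) of `pinnedChain ω₂ lam β γ`, the momentum coefficient of the total current at an
interior site with neighbours at `a, b` and own position `s`, `c = -(V'(s-a) + V'(b-s))/2`, has
`(b-a)²/4 ≤ c²` (the bracket `1 + β(x² - xy + y²)` is `≥ 1`). [folklore] -/
theorem sq_neighbour_dist_le_coeff_sq {β : ℝ} (hβ : 0 ≤ β) (ω₂ lam γ a b s : ℝ) :
    (b - a) ^ 2 / 4 ≤
      (-(deriv (Literature.MathematicalPhysics.KineticTheory.HeatConduction.pinnedChain ω₂ lam β γ).V (s - a) +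
          deriv (Literature.MathematicalPhysics.KineticTheory.HeatConduction.pinnedChain ω₂ lam β γ).V (b - s)) / 2) ^ 2 := by
  rw [Literature.MathematicalPhysics.KineticTheory.HeatConduction.pinnedChain_deriv_V,
    Literature.MathematicalPhysics.KineticTheory.HeatConduction.pinnedChain_deriv_V, interiorCoeff_eq]
  set x := s - a
  set y := b - s
  have hq : 0 ≤ x ^ 2 - x * y + y ^ 2 := by nlinarith [sq_nonneg (x - y), sq_nonneg x, sq_nonneg y]
  have hk : 1 ≤ 1 + β * (x ^ 2 - x * y + y ^ 2) := by nlinarith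
  have hk2 : 1 ≤ (1 + β * (x ^ 2 - x * y + y ^ 2)) ^ 2 := by nlinarith
  have e : (-(b - a) * (1 + β * (x ^ 2 - x * y + y ^ 2)) / 2) ^ 2 =
      (b - a) ^ 2 / 4 * (1 + β * (x ^ 2 - x * y + y ^ 2)) ^ 2 := by ring
  rw [e]
  nlinarith [sq_nonneg (b - a)]

variable {N : ℕ}

/-! ### The momentum coefficients of the current -/

/-- **The current is linear in the momenta**: `∑_i j_i(q,p) = ∑_m p_m c_m(q)` with the coefficient
`c_m(q) = ∑_j [j=m+1](-V'(q_j-q_m)/2) + ∑_i [m=i+1](-V'(q_m-q_i)/2)` (site `m` is the lower end of bond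
`(m,m+1)` and the upper end of bond `(m-1,m)`). [folklore] -/
theorem totalCurrent_eq_sum_momentum_mul_coeff (P : OscillatorChain) (x : PhaseSpace N) :
    ∑ i, P.bondCurrent N i x = ∑ m, x.2 m *
      ((∑ j : Fin N, if j.val = m.val + 1 then -(deriv P.V (x.1 j - x.1 m)) / 2 else 0) +
        ∑ i : Fin N, if m.val = i.val + 1 then -(deriv P.V (x.1 m - x.1 i)) / 2 else 0) := by
  unfold OscillatorChain.bondCurrent
  have hsplit : ∀ i j : Fin N, (if j.val = i.val + 1 then -((x.2 i + x.2 j) / 2 * deriv P.V (x.1 j - x.1 i)) else 0) =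
      x.2 i * (if j.val = i.val + 1 then -(deriv P.V (x.1 j - x.1 i)) / 2 else 0) +
        x.2 j * (if j.val = i.val + 1 then -(deriv P.V (x.1 j - x.1 i)) / 2 else 0) := by
    intro i j
    split_ifs <;> ring
  simp_rw [hsplit, Finset.sum_add_distrib, mul_add, Finset.sum_add_distrib]
  congr 1
  · simp_rw [Finset.mul_sum]
  · rw [Finset.sum_comm]
    simp_rw [Finset.mul_sum]

/-- The line derivative of the total current along the momentum direction `(0, e_m)` is the coefficient `c_m(q)`.
[folklore] -/
theorem hasLineDerivAt_totalCurrent_unitP (P : OscillatorChain) (x : PhaseSpace N) (m : Fin N) :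
    HasLineDerivAt ℝ (fun z : PhaseSpace N => ∑ i, P.bondCurrent N i z)
      ((∑ j : Fin N, if j.val = m.val + 1 then -(deriv P.V (x.1 j - x.1 m)) / 2 else 0) +
        ∑ i : Fin N, if m.val = i.val + 1 then -(deriv P.V (x.1 m - x.1 i)) / 2 else 0)
      x ((0, Pi.single m 1) : PhaseSpace N) := by
  unfold HasLineDerivAt
  set c : Fin N → ℝ := fun m' =>
    (∑ j : Fin N, if j.val = m'.val + 1 then -(deriv P.V (x.1 j - x.1 m')) / 2 else 0) +
      ∑ i : Fin N, if m'.val = i.val + 1 then -(deriv P.V (x.1 m' - x.1 i)) / 2 else 0 with hc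
  have h : (fun t : ℝ => ∑ i, P.bondCurrent N i (x + t • ((0, Pi.single m 1) : PhaseSpace N))) =
      fun t => (∑ m', x.2 m' * c m') + t * c m := by
    funext t
    rw [totalCurrent_eq_sum_momentum_mul_coeff]
    have h1 : (x + t • ((0, Pi.single m 1) : PhaseSpace N)).1 = x.1 := by simp
    simp only [h1]
    have h2 : ∀ m' : Fin N, (x + t • ((0, Pi.single m 1) : PhaseSpace N)).2 m' =
        x.2 m' + t * (Pi.single (M := fun _ : Fin N => ℝ) m 1 m') := fun m' => by
      simp [Pi.single_apply]
    simp only [h2, add_mul, Finset.sum_add_distrib]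
    congr 1
    rw [Finset.sum_eq_single m]
    · simp [hc]
    · intro b _ hb; simp [Pi.single_eq_of_ne hb]
    · intro h; exact absurd (Finset.mem_univ m) h
  rw [h]
  have h3 : HasDerivAt (fun t : ℝ => (∑ m', x.2 m' * c m') + t * c m) (c m) 0 := by
    simpa using ((hasDerivAt_id (0:ℝ)).mul_const (c m)).const_add (∑ m', x.2 m' * c m')
  exact h3

section Pinned

variable {ω₂ lam β : ℝ} (hω : 0 < ω₂) (hl : 0 ≤ lam) (hβ : 0 ≤ β) (γ : ℝ) (N : ℕ) {T : ℝ} (hT : 0 < T)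
include hω hl hβ hT

/-! ### Polynomial bounds on the ingredients -/

omit hT in
/-- `|c_m(q)| ≤ (3 + β)(1 + H)`: each of the (at most two) bond terms is `|V'|/2 ≤ (3+β)(1+H)/2`. [folklore] -/
theorem pinnedChain_abs_coeff_le (x : PhaseSpace N) (m : Fin N) :
    |(∑ j : Fin N, if j.val = m.val + 1 then -(deriv (pinnedChain ω₂ lam β γ).V (x.1 j - x.1 m)) / 2 else 0) +
        ∑ i : Fin N, if m.val = i.val + 1 then -(deriv (pinnedChain ω₂ lam β γ).V (x.1 m - x.1 i)) / 2 else 0| ≤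
      (3 + β) * (1 + (pinnedChain ω₂ lam β γ).hamiltonian N x) := by
  set P := pinnedChain ω₂ lam β γ with hP
  set H := P.hamiltonian N x with hH
  have hH0 : 0 ≤ H := pinnedChain_hamiltonian_nonneg hω.le hl hβ γ N x
  have hbond : ∀ i j : Fin N, j.val = i.val + 1 → |deriv P.V (x.1 j - x.1 i)| ≤ (3 + β) * (1 + H) := by
    intro i j hij
    rw [pinnedChain_deriv_V]
    exact abs_deriv_V_le hβ (pinnedChain_bond_le_hamiltonian hω.le hl hβ γ N x hij)
  have h1 : |∑ j : Fin N, (if j.val = m.val + 1 then -(deriv P.V (x.1 j - x.1 m)) / 2 else 0)| ≤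
      (3 + β) * (1 + H) / 2 := by
    have hterm : ∀ j : Fin N, |(if j.val = m.val + 1 then -(deriv P.V (x.1 j - x.1 m)) / 2 else 0)| ≤
        (if j.val = m.val + 1 then (3 + β) * (1 + H) / 2 else 0) := by
      intro j
      split_ifs with h
      · rw [abs_div, abs_neg, abs_two]
        linarith [hbond m j h]
      · simp
    calc |∑ j : Fin N, (if j.val = m.val + 1 then -(deriv P.V (x.1 j - x.1 m)) / 2 else 0)|
        ≤ ∑ j : Fin N, (if j.val = m.val + 1 then (3 + β) * (1 + H) / 2 else 0) :=
          (Finset.abs_sum_le_sum_abs _ _).trans (Finset.sum_le_sum fun j _ => hterm j)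
      _ = (3 + β) * (1 + H) / 2 * ∑ j : Fin N, (if j.val = m.val + 1 then (1:ℝ) else 0) := by
          rw [Finset.mul_sum]; exact Finset.sum_congr rfl fun j _ => by split_ifs <;> simp
      _ ≤ (3 + β) * (1 + H) / 2 * 1 := by
          refine mul_le_mul_of_nonneg_left ?_ (by positivity)
          rw [Finset.sum_boole]
          have : ((univ.filter fun j : Fin N => j.val = m.val + 1).card : ℝ) ≤ 1 := by
            exact_mod_cast Finset.card_le_one.2 fun a ha b hb => by
              rw [Finset.mem_filter] at ha hb; exact Fin.ext (by omega)
          simpa using this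
      _ = (3 + β) * (1 + H) / 2 := mul_one _
  have h2 : |∑ i : Fin N, (if m.val = i.val + 1 then -(deriv P.V (x.1 m - x.1 i)) / 2 else 0)| ≤
      (3 + β) * (1 + H) / 2 := by
    have hterm : ∀ i : Fin N, |(if m.val = i.val + 1 then -(deriv P.V (x.1 m - x.1 i)) / 2 else 0)| ≤
        (if m.val = i.val + 1 then (3 + β) * (1 + H) / 2 else 0) := by
      intro i
      split_ifs with h
      · rw [abs_div, abs_neg, abs_two]
        linarith [hbond i m h]
      · simp
    calc |∑ i : Fin N, (if m.val = i.val + 1 then -(deriv P.V (x.1 m - x.1 i)) / 2 else 0)|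
        ≤ ∑ i : Fin N, (if m.val = i.val + 1 then (3 + β) * (1 + H) / 2 else 0) :=
          (Finset.abs_sum_le_sum_abs _ _).trans (Finset.sum_le_sum fun i _ => hterm i)
      _ = (3 + β) * (1 + H) / 2 * ∑ i : Fin N, (if m.val = i.val + 1 then (1:ℝ) else 0) := by
          rw [Finset.mul_sum]; exact Finset.sum_congr rfl fun i _ => by split_ifs <;> simp
      _ ≤ (3 + β) * (1 + H) / 2 * 1 := by
          refine mul_le_mul_of_nonneg_left ?_ (by positivity)
          rw [Finset.sum_boole]
          have : ((univ.filter fun i : Fin N => m.val = i.val + 1).card : ℝ) ≤ 1 := by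
            exact_mod_cast Finset.card_le_one.2 fun a ha b hb => by
              rw [Finset.mem_filter] at ha hb; exact Fin.ext (by omega)
          simpa using this
      _ = (3 + β) * (1 + H) / 2 := mul_one _
  calc _ ≤ _ := abs_add_le _ _
    _ ≤ (3 + β) * (1 + H) / 2 + (3 + β) * (1 + H) / 2 := add_le_add h1 h2
    _ = (3 + β) * (1 + H) := by ring

omit hT in
/-- `|p_m| ≤ 1 + H` (since `p_m² ≤ 2H`). [folklore] -/
theorem pinnedChain_abs_momentum_le (x : PhaseSpace N) (m : Fin N) :
    |x.2 m| ≤ 1 + (pinnedChain ω₂ lam β γ).hamiltonian N x := by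
  have h := pinnedChain_abs_momentum_pow_le hω.le hl hβ γ N x m (k := 2) (by norm_num)
  have hH0 := pinnedChain_hamiltonian_nonneg hω.le hl hβ γ N x
  have h1 : x.2 m ^ 2 / 2 ≤ (pinnedChain ω₂ lam β γ).hamiltonian N x := by
    have := pinnedChain_harmonic_le_hamiltonian (ω₂ := ω₂) hl hβ γ N x
    have h2 : x.2 m ^ 2 / 2 ≤ ∑ k, x.2 k ^ 2 / 2 :=
      Finset.single_le_sum (f := fun k => x.2 k ^ 2 / 2) (fun k _ => by positivity) (Finset.mem_univ m)
    have h3 : 0 ≤ ∑ k, ω₂ * x.1 k ^ 2 / 2 := Finset.sum_nonneg fun k _ => by positivity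
    linarith
  have habs : |x.2 m| ≤ (1 + x.2 m ^ 2) / 2 := by nlinarith [sq_nonneg (|x.2 m| - 1), sq_abs (x.2 m), abs_nonneg (x.2 m)]
  linarith


/-! ### Gaussian integration by parts in each momentum -/

/-- **`⟨p_m c_m J⟩ = T⟨c_m²⟩`**: Gaussian integration by parts in the momentum `p_m` against `e^{-H/T}`
(`∂_{p_m} e^{-H/T} = -(p_m/T)e^{-H/T}`, `∂_{p_m}(c_m J) = c_m²`). [folklore] -/
theorem pinnedChain_integral_momentum_coeff_totalCurrent (m : Fin N) :
    ∫ x, x.2 m * ((∑ j : Fin N, if j.val = m.val + 1 then -(deriv (pinnedChain ω₂ lam β γ).V (x.1 j - x.1 m)) / 2 else 0) +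
        ∑ i : Fin N, if m.val = i.val + 1 then -(deriv (pinnedChain ω₂ lam β γ).V (x.1 m - x.1 i)) / 2 else 0) *
      (∑ i, (pinnedChain ω₂ lam β γ).bondCurrent N i x) * (pinnedChain ω₂ lam β γ).gibbsDensity N T x =
    T * ∫ x, ((∑ j : Fin N, if j.val = m.val + 1 then -(deriv (pinnedChain ω₂ lam β γ).V (x.1 j - x.1 m)) / 2 else 0) +
        ∑ i : Fin N, if m.val = i.val + 1 then -(deriv (pinnedChain ω₂ lam β γ).V (x.1 m - x.1 i)) / 2 else 0) ^ 2 *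
      (pinnedChain ω₂ lam β γ).gibbsDensity N T x := by
  set P := pinnedChain ω₂ lam β γ with hP
  set c : PhaseSpace N → ℝ := fun x =>
    (∑ j : Fin N, if j.val = m.val + 1 then -(deriv P.V (x.1 j - x.1 m)) / 2 else 0) +
      ∑ i : Fin N, if m.val = i.val + 1 then -(deriv P.V (x.1 m - x.1 i)) / 2 else 0 with hc
  set J : PhaseSpace N → ℝ := fun x => ∑ i, P.bondCurrent N i x with hJ
  set ρ : PhaseSpace N → ℝ := P.gibbsDensity N T with hρ
  set v : PhaseSpace N := ((0, Pi.single m 1) : PhaseSpace N) with hv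
  -- continuity
  have hVc : Continuous (deriv P.V) := by
    have : deriv P.V = fun r => r + β * r ^ 3 := funext fun r => pinnedChain_deriv_V ω₂ lam β γ r
    rw [this]; fun_prop
  have hcc : Continuous c := by
    simp only [hc]
    refine Continuous.add (continuous_finsetSum _ fun j _ => ?_) (continuous_finsetSum _ fun i _ => ?_)
    · split_ifs
      · exact ((hVc.comp (((continuous_apply j).comp continuous_fst).sub
          ((continuous_apply m).comp continuous_fst))).neg).div_const _
      · exact continuous_const
    · split_ifs
      · exact ((hVc.comp (((continuous_apply m).comp continuous_fst).sub
          ((continuous_apply i).comp continuous_fst))).neg).div_const _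
      · exact continuous_const
  have hJc : Continuous J := continuous_finsetSum _ fun i _ => pinnedChain_continuous_bondCurrent ω₂ lam β γ N i
  have hpc : Continuous fun x : PhaseSpace N => x.2 m := (continuous_apply m).comp continuous_snd
  -- bounds
  have hH0 : ∀ x, 0 ≤ P.hamiltonian N x := fun x => pinnedChain_hamiltonian_nonneg hω.le hl hβ γ N x
  have hcb : ∀ x, |c x| ≤ (3 + β) * (1 + P.hamiltonian N x) := fun x => pinnedChain_abs_coeff_le hω hl hβ γ N x m
  have hJb : ∀ x, |J x| ≤ N * (N * ((3 + β) / 2)) * (1 + P.hamiltonian N x) ^ 2 := by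
    intro x
    calc |J x| ≤ ∑ i, |P.bondCurrent N i x| := Finset.abs_sum_le_sum_abs _ _
      _ ≤ ∑ _i : Fin N, N * ((3 + β) / 2 * (1 + P.hamiltonian N x) ^ 2) :=
          Finset.sum_le_sum fun i _ => pinnedChain_abs_bondCurrent_le hω.le hl hβ γ N i x
      _ = N * (N * ((3 + β) / 2)) * (1 + P.hamiltonian N x) ^ 2 := by
          simp [Finset.sum_const, Finset.card_univ, Fintype.card_fin]; ring
  have hpb : ∀ x, |x.2 m| ≤ 1 + P.hamiltonian N x := fun x => pinnedChain_abs_momentum_le hω hl hβ γ N x m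
  -- line derivatives
  have hFd : ∀ x, HasLineDerivAt ℝ (fun z => c z * J z) (c x * c x) x v := by
    intro x
    have hJd : HasLineDerivAt ℝ J (c x) x v := hasLineDerivAt_totalCurrent_unitP P x m
    unfold HasLineDerivAt at hJd ⊢
    have hconst : ∀ t : ℝ, c (x + t • v) = c x := by
      intro t
      simp only [hc, hv]
      simp
    have h1 : (fun t : ℝ => c (x + t • v) * J (x + t • v)) = fun t => c x * J (x + t • v) := by
      funext t; rw [hconst t]
    show HasDerivAt (fun t : ℝ => c (x + t • v) * J (x + t • v)) (c x * c x) 0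
    rw [h1]
    exact hJd.const_mul (c x)
  have hgd : ∀ x, HasLineDerivAt ℝ ρ (-(x.2 m / T) * ρ x) x v := fun x =>
    P.hasLineDerivAt_gibbsDensity (P.hasLineDerivAt_hamiltonian_unitP N x m)
  -- integrability of the three products (all `≤ C (1+H)⁴`)
  have one_le : ∀ x, 1 ≤ 1 + P.hamiltonian N x := fun x => by linarith [hH0 x]
  have hI1 : Integrable fun x => (c x * c x) * ρ x := by
    refine pinnedChain_integrable_mul_gibbsDensity_of_le_pow_four hω hl hβ γ N hT (hcc.mul hcc)
      (C := (3 + β) ^ 2) fun x => ?_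
    rw [abs_mul]
    have h := hcb x
    have h1 : (1 + P.hamiltonian N x) ^ 2 ≤ (1 + P.hamiltonian N x) ^ 4 :=
      pow_le_pow_right₀ (one_le x) (by norm_num)
    calc |c x| * |c x| ≤ ((3 + β) * (1 + P.hamiltonian N x)) * ((3 + β) * (1 + P.hamiltonian N x)) :=
          mul_le_mul h h (abs_nonneg _) (by linarith [abs_nonneg (c x)])
      _ = (3 + β) ^ 2 * (1 + P.hamiltonian N x) ^ 2 := by ring
      _ ≤ (3 + β) ^ 2 * (1 + P.hamiltonian N x) ^ 4 := mul_le_mul_of_nonneg_left h1 (by positivity)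
  have hI2 : Integrable fun x => (c x * J x) * (-(x.2 m / T) * ρ x) := by
    have hgc : Continuous fun x : PhaseSpace N => c x * J x * (-(x.2 m / T)) :=
      (hcc.mul hJc).mul ((hpc.div_const T).neg)
    have h := pinnedChain_integrable_mul_gibbsDensity_of_le_pow_four hω hl hβ γ N hT
      (g := fun x => c x * J x * (-(x.2 m / T))) hgc (C := (3 + β) * (N * (N * ((3 + β) / 2))) * T⁻¹) fun x => by
        rw [abs_mul, abs_mul, abs_neg, abs_div, abs_of_pos hT]
        have e : (3 + β) * (N * (N * ((3 + β) / 2))) * T⁻¹ * (1 + P.hamiltonian N x) ^ 4 =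
            ((3 + β) * (1 + P.hamiltonian N x)) * (N * (N * ((3 + β) / 2)) * (1 + P.hamiltonian N x) ^ 2) *
              ((1 + P.hamiltonian N x) / T) := by rw [div_eq_mul_inv]; ring
        rw [e]
        have hH0x := hH0 x
        refine mul_le_mul (mul_le_mul (hcb x) (hJb x) (abs_nonneg _) (by linarith [abs_nonneg (c x), hcb x])) ?_
          (by positivity) (by positivity)
        exact div_le_div_of_nonneg_right (hpb x) hT.le
    refine h.congr (Filter.Eventually.of_forall fun x => ?_)
    show c x * J x * (-(x.2 m / T)) * P.gibbsDensity N T x = (c x * J x) * (-(x.2 m / T) * ρ x)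
    simp only [hρ]; ring
  have hI3 : Integrable fun x => (c x * J x) * ρ x := by
    refine pinnedChain_integrable_mul_gibbsDensity_of_le_pow_four hω hl hβ γ N hT (hcc.mul hJc)
      (C := (3 + β) * (N * (N * ((3 + β) / 2)))) fun x => ?_
    rw [abs_mul]
    have h1 : (1 + P.hamiltonian N x) ^ 3 ≤ (1 + P.hamiltonian N x) ^ 4 :=
      pow_le_pow_right₀ (one_le x) (by norm_num)
    calc |c x| * |J x| ≤ ((3 + β) * (1 + P.hamiltonian N x)) * (N * (N * ((3 + β) / 2)) * (1 + P.hamiltonian N x) ^ 2) :=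
          mul_le_mul (hcb x) (hJb x) (abs_nonneg _) (by linarith [abs_nonneg (c x), hcb x])
      _ = (3 + β) * (N * (N * ((3 + β) / 2))) * (1 + P.hamiltonian N x) ^ 3 := by ring
      _ ≤ (3 + β) * (N * (N * ((3 + β) / 2))) * (1 + P.hamiltonian N x) ^ 4 :=
          mul_le_mul_of_nonneg_left h1 (by positivity)
  -- integration by parts
  have hibp := integral_mul_eq_neg_of_hasLineDerivAt_of_integrable hI1 hI2 hI3 hFd hgd
  -- `∫ cJ (-(p/T)ρ) = -∫ c² ρ`  ⟹  `∫ p c J ρ = T ∫ c² ρ`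
  have e1 : ∫ x, (c x * J x) * (-(x.2 m / T) * ρ x) = -T⁻¹ * ∫ x, x.2 m * c x * J x * ρ x := by
    rw [← integral_const_mul]
    refine integral_congr_ae (Filter.Eventually.of_forall fun x => ?_)
    show (c x * J x) * (-(x.2 m / T) * ρ x) = -T⁻¹ * (x.2 m * c x * J x * ρ x)
    rw [div_eq_mul_inv]; ring
  have e2 : ∫ x, (c x * c x) * ρ x = ∫ x, c x ^ 2 * ρ x :=
    integral_congr_ae (Filter.Eventually.of_forall fun x => by show (c x * c x) * ρ x = c x ^ 2 * ρ x; ring)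
  rw [e1, e2] at hibp
  have h3 : T⁻¹ * ∫ x, x.2 m * c x * J x * ρ x = ∫ x, c x ^ 2 * ρ x := by linarith
  calc ∫ x, x.2 m * c x * J x * ρ x = T * (T⁻¹ * ∫ x, x.2 m * c x * J x * ρ x) := by
        rw [← mul_assoc, mul_inv_cancel₀ hT.ne', one_mul]
    _ = T * ∫ x, c x ^ 2 * ρ x := by rw [h3]

end Pinned

end Summit.AtomisticToContinuum.FouriersLaw.Theorems.ChainVariation

end
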